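import Summits.QuantumFields.BalabanUV.T4Continuum.Support.NE3FrameFreeSlice
import Summits.QuantumFields.BalabanUV.T4Continuum.Support.NE3LandauOrbit
import HarnessLib

/-!
# T⁴ programme, node NE3 — row E-MLw-(w4)-P, sub-row Φ6 (flat), file 1: THE CORNER-TRIVIAL GAUGE ORBIT MEETS THE FRAME-FREE
# BLOCK-LANDAU SLICE ONLY AT ZERO (`dPot Ξ₀ ∩ T_♮(1) = {0}`)

NE3 (node U1b) formalisation swarm `b2b-balaban-t4-ne3-formalise-*`, leaf seat `b2b-balaban-t4-ne3-formalise-leaf-01`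
(gen 5), row **Φ6** of the owner's ruling ρ-g21-3 ∕ `HOME/t4/b2b-balaban-t4-ne3-p1/g21/D-ne3p1-g21-2.md` §2 («chart L1 on
T_♮(W): `ker d(avg^k)(W) = D_W Ξ₀ ⊕ T_♮(W)` — flat first: dimension count + trivial intersection»); my CLAIM in `HOME/CLAIMS.log`
(2026-08-20 ≈15:39Z).  Over row NE3-R2's Φ1 `NE3FramePotGauge` ∕ `NE3FrameFreeSlice` (p223604 ∕ p223717) and leaf-04's Landau
orthogonality `NE3LandauOrbit.sum_hsR_gaugeDir` BY NAME.

WHY.  The frame-free block-Landau slice `frameFreeBlockLandau L N k` (the flat `T_♮(1)`) is meant to be a COMPLEMENT, inside the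
flat k-fold tangent space, of the corner-trivial gauge orbit `{dPot ξ : ξ = 0 on (L^k)•ℤ^d}`.  THIS FILE proves the
TRIVIAL-INTERSECTION half: a corner-trivial, periodic, gauge direction `dPot ξ` lying in the slice is ZERO.  Mechanism (exact
finite-dimensional linear algebra, no smallness): by Landau orthogonality at the flat background,
`Σ_x Σ_μ ‖dPot ξ‖²_HS = −Σ_x ⟨flatDiv (dPot ξ) x, ξ x⟩_HS`; on the slice the backward divergence is a block constant `c_z` off the
corners and `ξ` vanishes AT the corners, so the right-hand side is `−Σ_z ⟨c_z, Σ_{v∈B(z)} ξ⟩`, and the block sums of `ξ` vanish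
because `(bmean L)^[k] ξ = framePot L k (dPot ξ) + ξ(corner) = 0` ((‡) `NE3FramePotGauge.framePot_dPot` + frame-freeness +
corner-triviality).

CONTENT ([folklore]; 0 sorry; 0 def):
§1 `sum_nhsNormSq_dPot_eq` — `Σ_{x∈periodBox P} Σ_μ nhsNormSq (dPot ξ x μ) = −Σ_x hsR (flatDiv (dPot ξ) x) (ξ x)` for P-periodic ξ;
§2 `sum_block_eq_zero_of_framePot_dPot` — frame-free + corner-trivial ⇒ every block sum of ξ vanishes;
§3 **`dPot_eq_zero_of_mem_frameFreeBlockLandau`** — corner-trivial, `(N·L^k)`-periodic `ξ` with `dPot ξ ∈ frameFreeBlockLandau L N k`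
   (`L, N ≥ 1`, any `k`) ⇒ `dPot ξ = 0`.
(File 2∕3 of Φ6-flat, the block-mean-zero Poisson step ∕ existence of the slice representative, follows.)

HONEST FRAMING.  Flat linear algebra on our lattice objects; nothing about Bałaban's minimisers; (P_W), (ML_w), (μK)♮, T-E_w and
**NE3 are NOT proved**; spine PROVED 0∕9; finite T⁴ rung (B)+1 — NOT infinite volume, NOT mass gap, NOT `BetaPertH`, NOT Clay.
PLACEMENT: `Summits/QuantumFields/BalabanUV/`; imports accepted modules only.  HONEST DEPENDENCY (cell page 1): continuum YM
on T⁴ ⇐ BetaPertH ∧ nine spine estimates (0/9 proved); BetaPertH ⇐ (D1) ∧ (D4) ∧ CAP+tail; G-an2-4 gates asym, D1 and NE2/3/4.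
-/

set_option autoImplicit false

open scoped BigOperators Matrix.Norms.L2Operator
open Finset

namespace Summit.QuantumFields.BalabanUV.T4Continuum.NE3FrameFreeSliceUnique

open Literature.MathematicalPhysics.QuantumFieldTheory.Balaban1983to89
open B7Prop1Explicit B7Prop2Explicit MatrixNorms
open T4AveragingDeficitWall (IsSkewDir)
open T4AveragingDeficitWallBoundary (periodBox mem_periodBox)
open AveragingDeficitPeriodicCounting (IsPeriodicDir)
open AveragingDeficitTorusChart (eq_wrap_add periodic_smul_vec)
open MinimalActionWitness (flatCfg)
open BlockAveragePushDirGauge (gaugeDir)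
open NE3TangentNoGoWords (dPot)
open NE3CoercivityScaling (flatDiv)
open NE3TangentFlatStructure (framePot dPot_add_period)
open NE3CovariantCalculus (hsR hsR_self hsR_sum_right)
open NE3CovariantWeitzenbock (covDiv covDiv_flatCfg)
open NE3LandauOrbit (sum_hsR_gaugeDir eq_zero_of_nhsNormSq_eq_zero hsR_zero_left hsR_zero_right hsR_neg_right)
open NE3BlockLineAverage (sum_periodBox_blocks)
open NE3FramePotGauge (bmean framePot_dPot iterate_bmean_apply)
open NE3FrameFreeSlice (frameFreeBlockLandau)

noncomputable section

variable {d : ℕ} {n : Type*} [Fintype n] [DecidableEq n]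

/-! ## §1 The flat Landau identity for a gauge direction -/

/-- At the flat background the gauge direction is minus the coboundary: `gaugeDir 1 ξ (x, μ) = −dPot ξ x μ`. [folklore] -/
theorem gaugeDir_flatCfg_eq_neg_dPot (ξ : Site d → Matrix n n ℂ) (x : Site d) (μ : Fin d) :
    gaugeDir (flatCfg (d := d) (n := n)) ξ x μ = -dPot ξ x μ := by
  simp [gaugeDir, flatCfg, dPot, T4AveragingDeficitWall.Ad]

/-- At the flat background the covariant backward divergence is `flatDiv`. [folklore] -/
theorem covDiv_flatCfg_eq_flatDiv (ψ : Site d → Fin d → Matrix n n ℂ) (x : Site d) :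
    covDiv (flatCfg (d := d) (n := n)) ψ x = flatDiv ψ x := by
  rw [covDiv_flatCfg]; rfl

/-- **`Σ‖dPot ξ‖²_HS = −Σ⟨flatDiv (dPot ξ), ξ⟩_HS` ON THE TORUS** for a `P`-periodic `ξ` (`P ≥ 1`): Landau orthogonality
`NE3LandauOrbit.sum_hsR_gaugeDir` at the flat background with `Y = dPot ξ`, `λ = ξ`. [folklore] -/
theorem sum_nhsNormSq_dPot_eq {P : ℕ} (hP : 1 ≤ P) {ξ : Site d → Matrix n n ℂ}
    (hξ : ∀ (x : Site d) (τ : Fin d), ξ (x + (P : ℤ) • e τ) = ξ x) :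
    ∑ x ∈ periodBox (d := d) P, ∑ μ : Fin d, nhsNormSq (dPot ξ x μ)
      = -∑ x ∈ periodBox (d := d) P, hsR (flatDiv (dPot ξ) x) (ξ x) := by
  have hY : IsPeriodicDir (dPot ξ) (P : ℤ) := fun x τ μ => dPot_add_period hξ x τ μ
  have hU : T4AveragingDeficitWall.IsUnitaryCfg (flatCfg (d := d) (n := n)) := fun _ _ => (unitaryUnits (Matrix n n ℂ)).one_mem
  have h := sum_hsR_gaugeDir hP hU hY hξ
  simp_rw [gaugeDir_flatCfg_eq_neg_dPot, hsR_neg_right, hsR_self, covDiv_flatCfg_eq_flatDiv, Finset.sum_neg_distrib] at h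
  linarith

/-! ## §2 Frame-free corner-trivial gauge functions have vanishing block sums -/

/-- **(‡) READ BACKWARDS**: if `framePot L k (dPot ξ) z = 0` and `ξ` vanishes at the corner `(L^k)•z`, then the block sum
`Σ_{v∈[0,L^k)^d} ξ((L^k)•z + v)` vanishes (`(bmean L)^[k] ξ z = framePot + ξ(corner)`, `NE3FramePotGauge.framePot_dPot` ∕
`iterate_bmean_apply`). [folklore] -/
theorem sum_block_eq_zero_of_framePot_dPot {L : ℕ} (hL : 1 ≤ L) (k : ℕ) {ξ : Site d → Matrix n n ℂ} (z : Site d)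
    (hfp : framePot L k (dPot ξ) z = 0) (hc : ξ (((L ^ k : ℕ) : ℤ) • z) = 0) :
    ∑ v ∈ periodBox (d := d) (L ^ k), ξ (((L ^ k : ℕ) : ℤ) • z + v) = 0 := by
  have h1 := framePot_dPot hL k ξ z
  have hc' : ξ (((L : ℤ) ^ k) • z) = 0 := by
    have : ((L : ℤ) ^ k) = ((L ^ k : ℕ) : ℤ) := by push_cast; rfl
    rw [this]; exact hc
  rw [hfp, hc', sub_zero] at h1
  have h2 := iterate_bmean_apply hL k ξ z
  rw [← h1] at h2
  have hM : (((L ^ k : ℕ) : ℝ) ^ d)⁻¹ ≠ 0 := by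
    have : (0 : ℝ) < ((L ^ k : ℕ) : ℝ) ^ d := by
      have hLk : (0 : ℝ) < ((L ^ k : ℕ) : ℝ) := by exact_mod_cast pow_pos (by omega : 0 < L) k
      positivity
    exact inv_ne_zero this.ne'
  exact (smul_eq_zero.mp h2.symm).resolve_left hM

/-! ## §3 The trivial intersection -/

/-- Values on the period box determine a periodic function: if `f` is `P`-periodic along every axis and vanishes on
`periodBox P`, it vanishes everywhere. [folklore] -/
theorem eq_zero_of_periodic_of_box {α : Type*} [AddGroup α] {P : ℕ} (hP : 1 ≤ P) {f : Site d → α}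
    (hf : ∀ (x : Site d) (κ : Fin d), f (x + (P : ℤ) • e κ) = f x) (hbox : ∀ x ∈ periodBox (d := d) P, f x = 0) (x : Site d) :
    f x = 0 := by
  haveI : NeZero P := ⟨by omega⟩
  rw [eq_wrap_add P x, periodic_smul_vec hf]
  refine hbox _ ?_
  unfold periodBox
  exact Finset.mem_image_of_mem _ (Finset.mem_univ _)

/-- **THE CORNER-TRIVIAL GAUGE ORBIT MEETS THE SLICE ONLY AT ZERO**: for `L, N ≥ 1` (any `k`) and a `(N·L^k)`-periodic site field `ξ`
vanishing on the corner lattice `(L^k)•ℤ^d`, `dPot ξ ∈ frameFreeBlockLandau L N k ⇒ dPot ξ = 0`.  (With the existence half — every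
flat tangent direction is `dPot ξ + X`, `ξ` corner-trivial, `X` in the slice — this is the flat decomposition
`ker (Tcoarse L)^[k] = dPot Ξ₀ ⊕ T_♮(1)` of ruling ρ-g21-3 (V6).) [folklore] -/
theorem dPot_eq_zero_of_mem_frameFreeBlockLandau {L N k : ℕ} (hL : 1 ≤ L) (hN : 1 ≤ N)
    {ξ : Site d → Matrix n n ℂ} (hξP : ∀ (x : Site d) (τ : Fin d), ξ (x + ((N * L ^ k : ℕ) : ℤ) • e τ) = ξ x)
    (hξc : ∀ w : Site d, ξ (((L ^ k : ℕ) : ℤ) • w) = 0)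
    (hmem : dPot ξ ∈ frameFreeBlockLandau (d := d) (n := n) L N k) : dPot ξ = 0 := by
  obtain ⟨-, -, -, hfp, hdiv⟩ := hmem
  set M : ℕ := L ^ k with hMdef
  have hM : 1 ≤ M := Nat.one_le_pow _ _ hL
  have hP : 1 ≤ N * M := Nat.mul_pos (by omega) (by omega)
  -- §1 on the torus of side `N·M`
  have hS := sum_nhsNormSq_dPot_eq (d := d) (n := n) hP hξP
  -- §2: every block sum of ξ vanishes, hence every block of the right-hand side vanishes
  have hblock : ∀ z : Site d, ∑ v ∈ periodBox (d := d) M, hsR (flatDiv (dPot ξ) ((M : ℤ) • z + v)) (ξ ((M : ℤ) • z + v)) = 0 := by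
    intro z
    obtain ⟨c, hc⟩ := hdiv z
    have hsum : ∑ v ∈ periodBox (d := d) M, ξ ((M : ℤ) • z + v) = 0 := by
      have := sum_block_eq_zero_of_framePot_dPot (d := d) (n := n) hL k z (hfp z) (hξc z)
      simpa [hMdef] using this
    calc ∑ v ∈ periodBox (d := d) M, hsR (flatDiv (dPot ξ) ((M : ℤ) • z + v)) (ξ ((M : ℤ) • z + v))
        = ∑ v ∈ periodBox (d := d) M, hsR c (ξ ((M : ℤ) • z + v)) := by
          refine Finset.sum_congr rfl fun v hv => ?_
          by_cases hv0 : v = 0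
          · subst hv0
            have : ξ ((M : ℤ) • z + 0) = 0 := by rw [add_zero]; exact_mod_cast hξc z
            rw [this, hsR_zero_right, hsR_zero_right]
          · have h := hc v (by simpa [hMdef] using hv) hv0
            have hM' : (((L ^ k : ℕ) : ℤ)) = (M : ℤ) := by rw [hMdef]
            rw [hM'] at h
            rw [h]
      _ = hsR c (∑ v ∈ periodBox (d := d) M, ξ ((M : ℤ) • z + v)) := (hsR_sum_right _ _ _).symm
      _ = 0 := by rw [hsum, hsR_zero_right]
  have hR : ∑ x ∈ periodBox (d := d) (N * M), hsR (flatDiv (dPot ξ) x) (ξ x) = 0 := by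
    rw [show N * M = M * N from Nat.mul_comm _ _,
      ← sum_periodBox_blocks M N hM (fun x => hsR (flatDiv (dPot ξ) x) (ξ x))]
    exact Finset.sum_eq_zero fun z _ => hblock z
  rw [hR, neg_zero] at hS
  -- §3: a sum of squares vanishes termwise, then periodicity
  have hx : ∀ x ∈ periodBox (d := d) (N * M), ∀ μ : Fin d, dPot ξ x μ = 0 := by
    intro x hx μ
    have h1 := (Finset.sum_eq_zero_iff_of_nonneg fun y _ =>
      Finset.sum_nonneg fun ν _ => nhsNormSq_nonneg (dPot ξ y ν)).1 hS x hx
    have h2 := (Finset.sum_eq_zero_iff_of_nonneg fun ν _ => nhsNormSq_nonneg (dPot ξ x ν)).1 h1 μ (Finset.mem_univ μ)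
    exact eq_zero_of_nhsNormSq_eq_zero h2
  funext x μ
  have hper : ∀ (y : Site d) (τ : Fin d), (fun w => dPot ξ w μ) (y + ((N * M : ℕ) : ℤ) • e τ) = (fun w => dPot ξ w μ) y :=
    fun y τ => dPot_add_period hξP y τ μ
  exact eq_zero_of_periodic_of_box hP hper (fun y hy => hx y hy μ) x

end

end Summit.QuantumFields.BalabanUV.T4Continuum.NE3FrameFreeSliceUnique
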